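import Summits.BirchSwinnertonDyer.BirchSwinnertonDyer.Theorems.SignedLowerHalvesKobayashiMainConjectureSmallImageTeichSpanHeckeDefs
import Summits.BirchSwinnertonDyer.BirchSwinnertonDyer.Theorems.SignedLowerHalvesKobayashiMainConjectureSmallImageTeichSpanHeckePrelims
import HarnessLib

/-!
# Route `SignedLowerHalves`, crux `KobayashiMainConjectureSmallImage` (item stmt-BirchSwinnertonDyer-19002), line `birth_acns` v11,
# stub `stub_muOneSign_ns_ge5`: **the one-sign μ-rider at a supersingular prime ⟸ B⁰_ss (Conjecture B⁰ MODULO `T_p`)**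
# (cell `bsd-ssimc`, seat `bsd-line-slh-p3` gen 10, LEAD; THEOREMS ONLY; helper `--supports stmt-BirchSwinnertonDyer-19002`)

State before this file (p645198, p648205): `stub_muOneSign_ns_ge5` ⟸ CONJ B⁰ `TeichSpanGen N_E p` at the conductor level of every
pair of the class.  B⁰ quantifies over EVERY `ι`-even functional on the `p`-power winding classes of `Γ₀(N_E)`; in particular it
asserts Greenberg's `μ(ω⁰) = 0` for every ORDINARY and every Eisenstein eigensystem of that level — content the supersingular rider
never uses.  THIS FILE removes it: because `a_p(f) ≡ 0 (mod p)`, Manin's functional `m = 2([γ·0]⁺ − [0]⁺)` of the newform KILLS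
(mod `p`, once `[0]⁺ ≡ 0`) the `T_p`-images `heckePImages N p` of the winding classes (MTT §I.4 (4.2)), so the f3-mu dictionary runs
with the LARGER generating set `teichSpanHeckeGenerators N p` — i.e. from the WEAKER hypothesis B⁰_ss = `TeichSpanGenModHecke N p`
(`…SmallImageTeichSpanHeckeDefs`, this seat): «`(1+ι)·V(N,p) ⊆ span{A_n(u)} + T_p·V(N,p)` mod `p`».

* §B `exists_one_le_norm_teichOrbitSum_of_teichSpanGenModHecke` — LEVEL FORM (`f` rational newform on `Γ₀(N)`, `p` odd, `p ∤ N`,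
  `p ∣ a_p(f)`, Eisenstein multiple prime to `p`): B⁰_ss at `(N,p)` + winding non-constancy mod `p` ⟹ SOME orbit sum `S_f(p,n,b)`,
  `n ≥ 1`, has norm `≥ 1`.  Contrapositive of the f3-mu dictionary: all `S ≡ 0` ⟹ `[0]⁺ ≡ 0` (`S(1,1) = (a_p − 2)[0]⁺`) ⟹ Manin's hom
  `m mod p` kills packets, torsion, parabolics, `p`-th powers, commutators AND the `T_p`-images (prelims `sum_heckePImage_eq`) ⟹ B⁰_ss
  gives `2m(γ) ≡ 0` on good `γ` ⟹ constant winding function (prelims `norm_sub_lt_one_of_forall_isGoodAt`) — contradiction.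
* §C `exists_sign_hasUnitContent_of_teichSpanGenModHecke` — CURVE FORM at any odd good supersingular `p` with `a_p = 0` (Serre Prop. 12,
  input-free THEOREM B road, Eisenstein multiple, §B; a unit orbit sum IS a unit coefficient of Pollack's `θ_n`, Module 1 p636207);
  `…_of_teichSpanGenModHeckeAll` from B⁰_ss at all levels.
* §D `muOneSign_ns_ge5_of_teichSpanGenModHecke_conductor` — the registered stub `stub_muOneSign_ns_ge5` (lines `birth_acns` v11/v12),
  VERBATIM, from «B⁰_ss at the conductor level of every pair of the class»; `…_of_teichSpanGenModHeckeAll` from the closed `Prop`.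
HONEST SCOPE: B⁰_ss is NOT proved at any level (it contains the one-signed Perrin-Riou conjecture for every residually supersingular
weight-2 eigensystem of level `N`, Pollack–Weston 2011 Rem. 4.2); the stub is NOT discharged; crux 4 stays OPEN; BSD is not proved by
any of this; no summit statement is proved by this seat.
References: [Manin1972] 1.4; [MazurTateTeitelbaum1986Invent] §I.4, §I.10; [Pollack2003] 6.15–6.16; [PollackWeston2011] 4.1–4.2; [Serre1972] Prop. 12.
-/

-- D-0017: single-problem summit, the namespace repeats the problem name by design.
set_option linter.dupNamespace false
set_option autoImplicit false

noncomputable section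

open scoped Classical MatrixGroups ModularForm
open CongruenceSubgroup Literature.NumberTheory.EllipticCurves.Rank1Residual

namespace Summit.BirchSwinnertonDyer.BirchSwinnertonDyer.Theorems.SmallImageTeichSpanHecke

open Matrix Matrix.SpecialLinearGroup Polynomial
  Literature.NumberTheory.EllipticCurves Literature.NumberTheory.EllipticCurves.ModularForms
  Literature.NumberTheory.EllipticCurves.Kobayashi2003 Literature.NumberTheory.EllipticCurves.GreenbergVatsal2000
  Summit.BirchSwinnertonDyer.BirchSwinnertonDyer.Theorems.CollapseThree
  Summit.BirchSwinnertonDyer.BirchSwinnertonDyer.Theorems.PrintX8VerticalStevens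
  Summit.BirchSwinnertonDyer.BirchSwinnertonDyer.Cruxes.AnalyticMuZeroX9.TeichSpan
open Summit.BirchSwinnertonDyer.BirchSwinnertonDyer.Theorems.SmallImageOrbitSumMu (exists_sign_hasUnitContent_of_norm_coeff_eq_one)
open Summit.BirchSwinnertonDyer.BirchSwinnertonDyer.Theorems.SmallImageTeichOrbitMu (teichOrbitSum_eq_coeff_comp_mazurTateElement)
open Summit.BirchSwinnertonDyer.BirchSwinnertonDyer.Theorems.SmallImageTeichSpanHeckePrelims (sum_heckePImage_eq norm_sub_lt_one_of_forall_isGoodAt)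

/-! ### §B The dictionary from B⁰_ss — level form -/

section Dictionary

variable {N : ℕ} [NeZero N] {f : CuspForm (Gamma0 N) 2} {p : ℕ} [Fact p.Prime]

/-- **The dictionary from B⁰_ss, level form.**  `f` a rational normalised newform on `Γ₀(N)`, `p` an odd prime with `p ∤ N`,
`a_p(f) = ap ∈ ℤ` with `p ∣ ap` (residually SUPERSINGULAR — for the newform of an elliptic curve with good supersingular reduction at
`p ≥ 5`, `ap = 0`), `n₀{∞,0}_f ∈ Λ_f` for some `n₀` prime to `p` (the Eisenstein multiple making `[·]⁺_f` `p`-integral at the `p`-power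
cusps).  IF B⁰_ss holds at `(N,p)` (`TeichSpanGenModHecke N p`) AND the winding function is non-constant mod `p`, THEN some
Teichmüller-orbit sum `S_f(p,n,b)` (`n ≥ 1`, `b ∈ (ℤ/pⁿ)ˣ`) has `p`-adic norm `≥ 1` (hence `= 1`).
Proof (contrapositive): all `S_f(p,n,b) ≡ 0` ⟹ `[0]⁺ ≡ 0` (`S(1,1) = (a_p − 2)[0]⁺`, `p ∣ a_p`, `p` odd) ⟹ Manin's homomorphism
`γ ↦ m(γ) = 2([γ·0]⁺ − [0]⁺) mod p` kills every generator of B⁰_ss — packets (`Σ m/2 = S − (p−1)[0]⁺`), finite-order and trace-`±2`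
elements, `p`-th powers, commutators, and the `T_p`-images (`Σ m/2 = a_p[v/p^{n+1}]⁺ − (p+1)[0]⁺` by MTT (4.2), prelims) ⟹ by B⁰_ss
`2m(γ) ≡ 0` for every good `γ` ⟹ `[b/pᵏ]⁺ ≡ [0]⁺` for all `b, k` ⟹ the winding function is constant mod `p`.
[cite: Manin1972, Prop. 1.4] [cite: MazurTateTeitelbaum1986Invent, §I.4 (4.2), §I.10 (10.1)–(10.2)] -/
theorem exists_one_le_norm_teichOrbitSum_of_teichSpanGenModHecke (hf : IsNewform0 f) (hQ : coeffField f = ⊥) (hp2 : p ≠ 2)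
    (hpN : ¬ p ∣ N) {ap : ℤ} (hap : cuspCoeff f p = ap) (hpap : (p : ℤ) ∣ ap) {n₀ : ℤ} (hpn₀ : ¬ (p : ℤ) ∣ n₀)
    (h0 : (n₀ : ℂ) * modularSymbol f 0 ∈ periodLattice f) (hB : TeichSpanGenModHecke N p)
    (hw : ∃ (n : ℕ) (a a' : ℤ), 1 ≤ ‖((ratPlusSymbol f ((a : ℚ) / (p : ℚ) ^ n) -
      ratPlusSymbol f ((a' : ℚ) / (p : ℚ) ^ n) : ℚ) : ℚ_[p])‖) :
    ∃ n : ℕ, 1 ≤ n ∧ ∃ b : (ZMod (p ^ n))ˣ,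
      1 ≤ ‖((teichOrbitSum f p n (b : ZMod (p ^ n)) : ℚ) : ℚ_[p])‖ := by
  classical
  have hp : p.Prime := Fact.out
  have hpZ : Prime (p : ℤ) := Nat.prime_iff_prime_int.mp hp
  -- period data (Manin 1972 / the period convention `re Λ_f = ℤ·Ω⁺/2`), as in the f3-mu dictionary
  have hreal : ∀ n, (cuspCoeff f n).im = 0 := cuspCoeff_im_eq_zero_of_coeffField_eq_bot hQ
  have hrat : ∀ r : ℚ, (ratPlusSymbol f r : ℝ) = normalizedPlusSymbol f r :=
    fun r ↦ ratCast_ratPlusSymbol_holds hf hQ r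
  have hΩpos : 0 < plusPeriod f := (plusPeriod_pos_and_realPeriods_eq isZLattice_periodLattice_holds hf hQ).1
  have hΩ : plusPeriod f ≠ 0 := hΩpos.ne'
  have hΩ2 : plusPeriod f / 2 ≠ 0 := div_ne_zero hΩ two_ne_zero
  obtain ⟨hre, -⟩ := realPeriods_eq_zmultiples_of_plusPeriod_ne_zero f hΩ
  choose m hm using exists_re_cuspSymbol_eq f hre
  have hm_zero : ∀ γ, cuspSymbol f γ = 0 → m γ = 0 := by
    intro γ hγ
    have h := hm γ
    rw [hγ, Complex.zero_re] at h
    exact_mod_cast (mul_eq_zero.mp h.symm).resolve_right hΩ2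
  have hm_mul : ∀ γ δ, m (γ * δ) = m γ + m δ := by
    intro γ δ
    have h2 : (cuspSymbol f (γ * δ)).re = (cuspSymbol f γ).re + (cuspSymbol f δ).re := by
      rw [cuspSymbol_mul_holds f γ δ, Complex.add_re]
    rw [hm, hm, hm, ← add_mul] at h2
    exact_mod_cast mul_right_cancel₀ hΩ2 h2
  have hm_one : m 1 = 0 := hm_zero 1 (cuspSymbol_one f)
  have hm_pow : ∀ (γ : Gamma0 N) (n : ℕ), m (γ ^ n) = n * m γ := by
    intro γ n
    induction n with
    | zero => simp [hm_one]
    | succ n ih => rw [pow_succ, hm_mul, ih]; push_cast; ring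
  have hm_list : ∀ l : List (Gamma0 N), m l.prod = (l.map m).sum := by
    intro l
    induction l with
    | nil => simp [hm_one]
    | cons g l ih => rw [List.prod_cons, hm_mul, ih, List.map_cons, List.sum_cons]
  -- Manin at `r = 0`: `[b/d]⁺ − [0]⁺ = m(γ)/2` for `γ = (a b; c d)`, `d ≠ 0`
  have hcusp : ∀ γ : Gamma0 N, dEntry γ ≠ 0 →
      ratPlusSymbol f (((bEntry γ : ℤ) : ℚ) / ((dEntry γ : ℤ) : ℚ)) - ratPlusSymbol f 0 = (m γ : ℚ) / 2 := by
    intro γ hd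
    have hd' : ((γ : SL(2, ℤ)) 1 0 : ℚ) * 0 + ((γ : SL(2, ℤ)) 1 1 : ℚ) ≠ 0 := by
      rw [mul_zero, zero_add]; exact_mod_cast hd
    have h := ratCast_ratPlusSymbol_moebius_sub f hrat hreal γ 0 hd'
    simp only [mul_zero, zero_add] at h
    rw [hm] at h
    have h' : ((ratPlusSymbol f (((bEntry γ : ℤ) : ℚ) / ((dEntry γ : ℤ) : ℚ)) - ratPlusSymbol f 0 : ℚ) : ℝ) =
        (((m γ : ℚ) / 2 : ℚ) : ℝ) := by
      push_cast
      rw [show ((bEntry γ : ℤ) : ℚ) = ((γ : SL(2, ℤ)) 0 1 : ℚ) from rfl,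
        show ((dEntry γ : ℤ) : ℚ) = ((γ : SL(2, ℤ)) 1 1 : ℚ) from rfl, h]
      field_simp
    exact_mod_cast h'
  -- integrality of the symbols at the `p`-power cusps
  have hint : ∀ (k n : ℕ), ‖((ratPlusSymbol f ((k : ℚ) / (p : ℚ) ^ n) : ℚ) : ℚ_[p])‖ ≤ 1 := by
    intro k n
    have hcop : Nat.Coprime (p ^ n) N := Nat.Coprime.pow_left n ((Nat.Prime.coprime_iff_not_dvd hp).mpr hpN)
    have hx := coprime_den_of_coprime (N := N) hcop (k : ℤ)
    rw [Int.cast_natCast, Nat.cast_pow] at hx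
    exact norm_ratPlusSymbol_le_one f hp2 hpn₀ h0 hx
  have hint0 : ‖((ratPlusSymbol f 0 : ℚ) : ℚ_[p])‖ ≤ 1 := by
    have h := hint 0 0
    rwa [Nat.cast_zero, zero_div] at h
  have hintS : ∀ (n : ℕ) (a : ZMod (p ^ n)), ‖((teichOrbitSum f p n a : ℚ) : ℚ_[p])‖ ≤ 1 :=
    norm_teichOrbitSum_le_one hint
  have hapn : ‖((ap : ℚ) : ℚ_[p])‖ < 1 := by
    have h : ‖((ap : ℤ) : ℚ_[p])‖ < 1 := Padic.norm_intCast_lt_one_iff.mpr hpap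
    exact_mod_cast h
  -- suppose, for contradiction, that every orbit sum at each level `≥ 1` over a unit is `≡ 0 (mod p)`
  by_contra H
  push Not at H
  have hsmall : ∀ (k : ℕ) (u : ZMod (p ^ (k + 1))), IsUnit u →
      ‖((teichOrbitSum f p (k + 1) u : ℚ) : ℚ_[p])‖ < 1 := by
    intro k u hu
    have h := H (k + 1) (by omega) hu.unit
    rwa [IsUnit.unit_spec] at h
  -- `[0]⁺ ≡ 0`: `S(1,1) = (a_p − 2)[0]⁺ ≡ 0` and `a_p[0]⁺ ≡ 0`, `p` odd
  have hzero : ‖((ratPlusSymbol f 0 : ℚ) : ℚ_[p])‖ < 1 := by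
    have hS1 := hsmall 0 1 isUnit_one
    have hX0 : teichOrbitSum f p (0 + 1) 1 = ((ap : ℚ) - 2) * ratPlusSymbol f 0 := by
      have h := teichOrbitSum_one_eq hf hpN hap hrat hp2 1
      rw [Units.val_one] at h
      exact h
    rw [hX0] at hS1
    push_cast at hS1
    have hA : ‖((ap : ℚ) : ℚ_[p]) * ((ratPlusSymbol f 0 : ℚ) : ℚ_[p])‖ < 1 := by
      rw [mul_comm]; exact padic_norm_mul_lt_one hint0 hapn
    have h2u : ‖(2 : ℚ_[p])‖ = 1 := by
      have h : ‖((2 : ℤ) : ℚ_[p])‖ = 1 := by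
        refine le_antisymm (Padic.norm_int_le_one 2) (not_lt.mp fun hlt ↦ ?_)
        have hd : (p : ℤ) ∣ 2 := Padic.norm_intCast_lt_one_iff.mp hlt
        exact hp2 ((Nat.prime_dvd_prime_iff_eq hp Nat.prime_two).mp (by exact_mod_cast hd))
      exact_mod_cast h
    have e : (2 : ℚ_[p]) * ((ratPlusSymbol f 0 : ℚ) : ℚ_[p]) =
        ((ap : ℚ) : ℚ_[p]) * ((ratPlusSymbol f 0 : ℚ) : ℚ_[p]) -
          ((((ap : ℚ) : ℚ_[p]) - 2) * ((ratPlusSymbol f 0 : ℚ) : ℚ_[p])) := by ring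
    have h2x : ‖(2 : ℚ_[p]) * ((ratPlusSymbol f 0 : ℚ) : ℚ_[p])‖ < 1 := by
      rw [e]; exact norm_sub_lt_one hA hS1
    rwa [norm_mul, h2u, one_mul] at h2x
  -- hence every orbit sum at level `k + 1` over a unit is `≡ −[0]⁺`
  have horb : ∀ (k : ℕ) (u : ZMod (p ^ (k + 1))), IsUnit u →
      ‖((teichOrbitSum f p (k + 1) u + ratPlusSymbol f 0 : ℚ) : ℚ_[p])‖ < 1 := by
    intro k u hu
    have h := padic_norm_add_lt_one (hsmall k u hu) hzero
    push_cast at h ⊢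
    exact h
  -- the reduction of `m` mod `p` as a homomorphism `Γ₀(N) → ℤ/p`
  let φ : Gamma0 N →* Multiplicative (ZMod p) :=
    { toFun := fun γ ↦ Multiplicative.ofAdd (((m γ : ℤ) : ZMod p))
      map_one' := by simp [hm_one]
      map_mul' := fun γ δ ↦ by simp [hm_mul, ofAdd_add] }
  have hφ : ∀ γ, φ γ = 1 ↔ (p : ℤ) ∣ m γ := by
    intro γ
    simp [φ, ZMod.intCast_zmod_eq_zero_iff_dvd]
  have hφ_list : ∀ l : List (Gamma0 N), φ l.prod = 1 ↔ (p : ℤ) ∣ (l.map m).sum := by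
    intro l
    rw [hφ, hm_list]
  -- every generator of B⁰_ss lies in the kernel
  have hker : Subgroup.closure (teichSpanHeckeGenerators N p) ⊔ commutator (Gamma0 N) ≤ φ.ker := by
    refine sup_le ?_ (Abelianization.commutator_subset_ker φ)
    rw [Subgroup.closure_le]
    rintro γ (((⟨n, l, hn, hl, rfl⟩ | hγ) | ⟨h, rfl⟩) | ⟨n, b, l, δ, hlen, hl, hnd, hdδ, hbδ, rfl⟩)
    · -- packet products: `Σ_g m(g)/2 = S(n,u) − (p−1)[0]⁺ ≡ 0`
      obtain ⟨k, rfl⟩ : ∃ k, n = k + 1 := ⟨n - 1, by omega⟩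
      have hlnd : l.Nodup := hl.2.2.1.of_map _
      have hlen : l.length = p - 1 := hl.1
      obtain ⟨u, hu⟩ := exists_sum_packet_eq_teichOrbitSum (f := f) hp2 hn hl
      rw [← List.sum_toFinset _ hlnd] at hu
      have hmsum : ((((l.map m).sum : ℤ) : ℚ) / 2 : ℚ) =
          teichOrbitSum f p (k + 1) (u : ZMod (p ^ (k + 1))) - ((p - 1 : ℕ) : ℚ) * ratPlusSymbol f 0 := by
        rw [← hu, Int.cast_list_sum, List.map_map, ← List.sum_toFinset _ hlnd, Finset.sum_div,
          ← hlen, ← List.toFinset_card_of_nodup hlnd]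
        rw [show ((l.toFinset.card : ℕ) : ℚ) * ratPlusSymbol f 0 = ∑ g ∈ l.toFinset, ratPlusSymbol f 0 by
          rw [Finset.sum_const, nsmul_eq_mul], ← Finset.sum_sub_distrib]
        refine Finset.sum_congr rfl fun g hg ↦ ?_
        rw [List.mem_toFinset] at hg
        have hd := dEntry_eq_of_isTeichPacket hl hg
        have hd0 : dEntry g ≠ 0 := by rw [hd]; exact pow_ne_zero _ (by exact_mod_cast hp.ne_zero)
        rw [Function.comp_apply, ← hcusp g hd0, hd]
        push_cast
        rfl
      have hdvd : (p : ℤ) ∣ (l.map m).sum := by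
        apply dvd_of_norm_div_two_lt_one hp2
        rw [hmsum, show teichOrbitSum f p (k + 1) (u : ZMod (p ^ (k + 1))) - ((p - 1 : ℕ) : ℚ) * ratPlusSymbol f 0
          = (teichOrbitSum f p (k + 1) (u : ZMod (p ^ (k + 1))) + ratPlusSymbol f 0) - (p : ℚ) * ratPlusSymbol f 0
          by rw [Nat.cast_sub hp.one_le, Nat.cast_one]; ring]
        push_cast
        have h1 := horb k (u : ZMod (p ^ (k + 1))) u.isUnit
        push_cast at h1
        exact norm_sub_lt_one h1 (norm_natCast_mul_lt_one hint0)
      rw [SetLike.mem_coe, MonoidHom.mem_ker, hφ_list]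
      exact hdvd
    · rw [SetLike.mem_coe, MonoidHom.mem_ker, hφ]
      rcases hγ with hfin | htr
      · exact ⟨0, by rw [hm_zero γ (cuspSymbol_eq_zero_of_isOfFinOrder f hfin), mul_zero]⟩
      · exact ⟨0, by rw [hm_zero γ (cuspSymbol_eq_zero_of_trEntry f htr), mul_zero]⟩
    · -- `p`-th powers
      rw [SetLike.mem_coe, MonoidHom.mem_ker, hφ, hm_pow]
      exact ⟨m h, by ring⟩
    · -- `T_p`-images: `(Σ_g m(g) + m(δ))/2 = a_p [v/p^{n+1}]⁺ − (p+1)[0]⁺ ≡ 0` (prelims `sum_heckePImage_eq`)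
      haveI : NeZero (p ^ (n + 1)) := ⟨pow_ne_zero _ hp.ne_zero⟩
      have hval := sum_heckePImage_eq hf hpN hap hrat (μ := fun γ ↦ (m γ : ℚ) / 2)
        (fun γ hd ↦ (hcusp γ hd).symm) n b hlen hl hnd hdδ hbδ
      have hdiv : ∀ l' : List (Gamma0 N), (((l'.map m).sum : ℤ) : ℚ) / 2 = (l'.map fun g ↦ (m g : ℚ) / 2).sum := by
        intro l'
        induction l' with
        | nil => simp
        | cons g l' ih => simp only [List.map_cons, List.sum_cons, Int.cast_add, add_div, ih]
      have hsum2 : ((((l.map m).sum + m δ : ℤ) : ℚ) / 2 : ℚ) =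
          (ap : ℚ) * ratPlusSymbol f ((((b : ZMod (p ^ (n + 1))).val : ℚ)) / (p : ℚ) ^ (n + 1)) -
            ((p : ℚ) + 1) * ratPlusSymbol f 0 := by
        rw [Int.cast_add, add_div, hdiv l]
        exact hval
      have hdvd : (p : ℤ) ∣ (l.map m).sum + m δ := by
        apply dvd_of_norm_div_two_lt_one hp2
        rw [hsum2]
        push_cast
        refine norm_sub_lt_one ?_ ?_
        · rw [mul_comm]
          exact padic_norm_mul_lt_one (hint _ (n + 1)) hapn
        · have hp1 : ‖(p : ℚ_[p]) + 1‖ ≤ 1 :=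
            (Padic.nonarchimedean _ _).trans (max_le (le_of_lt Padic.norm_p_lt_one) (by rw [norm_one]))
          exact padic_norm_mul_lt_one hp1 hzero
      rw [SetLike.mem_coe, MonoidHom.mem_ker, hφ, hm_mul, hm_list]
      exact hdvd
  -- B⁰_ss: for every good `γ`, `γ·γ^ι ∈ ker φ`, i.e. `p ∣ m γ + m(ιγ) = 2 m γ`, so `[b/d]⁺ ≡ [0]⁺`
  have hp2Z : ¬ (p : ℤ) ∣ 2 := fun h ↦
    hp2 ((Nat.prime_dvd_prime_iff_eq hp Nat.prime_two).mp (by exact_mod_cast h))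
  have hgood : ∀ γ : Gamma0 N, IsGoodAt p γ →
      ‖((ratPlusSymbol f (((bEntry γ : ℤ) : ℚ) / ((dEntry γ : ℤ) : ℚ)) - ratPlusSymbol f 0 : ℚ) : ℚ_[p])‖ < 1 := by
    intro γ hγ
    obtain ⟨e, he⟩ := hγ
    have hd0 : dEntry γ ≠ 0 := by
      intro h; rw [h, Int.natAbs_zero] at he; exact pow_ne_zero e hp.ne_zero he.symm
    have hι : m (iotaGamma0 γ) = m γ := by
      have h1 := hcusp (iotaGamma0 γ) (by rwa [dEntry_iotaGamma0])
      rw [bEntry_iotaGamma0, dEntry_iotaGamma0, Int.cast_neg, neg_div, ratPlusSymbol_neg f, hcusp γ hd0] at h1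
      have h2 : (m (iotaGamma0 γ) : ℚ) = m γ := by linarith
      exact_mod_cast h2
    have h2 : (p : ℤ) ∣ m (γ * iotaGamma0 γ) := (hφ _).mp (hker (hB γ ⟨e, he⟩))
    rw [hm_mul, hι, ← two_mul] at h2
    have hdvd : (p : ℤ) ∣ m γ := (hpZ.dvd_or_dvd h2).resolve_left hp2Z
    rw [hcusp γ hd0]
    exact norm_div_two_lt_one_of_dvd hp2 hdvd
  -- every `p`-power cusp: `[b/p^k]⁺ ≡ [0]⁺` (prelims `norm_sub_lt_one_of_forall_isGoodAt`)
  have hall := norm_sub_lt_one_of_forall_isGoodAt f hpN hgood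
  -- contradiction with the non-constancy of the winding function
  obtain ⟨n, a, a', hw⟩ := hw
  have h := norm_sub_lt_one (hall n a) (hall n a')
  rw [← Rat.cast_sub, show ratPlusSymbol f ((a : ℚ) / (p : ℚ) ^ n) - ratPlusSymbol f 0 -
      (ratPlusSymbol f ((a' : ℚ) / (p : ℚ) ^ n) - ratPlusSymbol f 0) =
      ratPlusSymbol f ((a : ℚ) / (p : ℚ) ^ n) - ratPlusSymbol f ((a' : ℚ) / (p : ℚ) ^ n) by ring] at h
  exact absurd hw (not_le.mpr h)

end Dictionary

/-! ### §C Curve form: the one-sign μ-rider from B⁰_ss at the newform's level -/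

section Rider

variable {N : ℕ} [NeZero N] (f : CuspForm (Gamma0 N) 2) {p : ℕ} [Fact p.Prime]

/-- **One orbit sum of norm `≥ 1` ⇒ a signed Pollack function with unit content** (per newform, any odd good supersingular prime
with `a_p = 0`): `p`-integrality makes `S_f(p,n,b)` a unit; `b = η̄₀γˢ` (`exists_coe_eq_toZModPow_mul_pow`); the orbit sum IS the
coefficient of `(1+T)ˢ` in Pollack's ω⁰ Mazur–Tate element `θ_{n-1}` (p645198 §1); a unit coefficient forces one signed function with
unit content (Module 1, p636207).
[cite: MazurTateTeitelbaum1986Invent, §I.10 (10.1)] [cite: Pollack2003, Def. 6.15 and Remark 6.16] [cite: PollackWeston2011, Thm. 4.1 (1)] -/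
theorem exists_sign_hasUnitContent_of_one_le_norm_teichOrbitSum {W : WeierstrassCurve ℚ} [W.IsElliptic] [W.IsGloballyMinimal]
    (hp2 : p ≠ 2) (hf : IsNewformOf W f) (hgood : W.HasGoodReductionAtPrime p) (hap : W.frobeniusTrace p = 0)
    (hT : ∃ n : ℕ, 1 ≤ n ∧ ∃ b : (ZMod (p ^ n))ˣ, 1 ≤ ‖((teichOrbitSum f p n (b : ZMod (p ^ n)) : ℚ) : ℚ_[p])‖) :
    ∃ (ε : ℤˣ) (L : IwasawaAlgebra p), IsSignedPAdicLFunction f p ε L ∧ HasUnitContent L := by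
  have hp : p.Prime := Fact.out
  have hpN : ¬ p ∣ N := not_dvd_level_of_isNewformOf hf hgood
  have hap' : cuspCoeff f p = ((0 : ℤ) : ℂ) := by
    rw [cuspCoeff_eq_frobeniusTrace_of_isNewformOf_holds hf hgood, hap]
  obtain ⟨m, hm, b, h1⟩ := hT
  have hb1 : ‖((teichOrbitSum f p m (b : ZMod (p ^ m)) : ℚ) : ℚ_[p])‖ = 1 :=
    le_antisymm
      (Summit.BirchSwinnertonDyer.BirchSwinnertonDyer.Theorems.SmallImageTeichOrbitMu.norm_teichOrbitSum_le_one
        f hp2 hf.1 hpN hap' m _) h1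
  obtain ⟨n, rfl⟩ : ∃ n, m = n + 1 := ⟨m - 1, by omega⟩
  obtain ⟨ξ₀, s, hb⟩ := exists_coe_eq_toZModPow_mul_pow hp2 n b
  have hs : s.val < p ^ n := by
    haveI : NeZero (p ^ n) := ⟨pow_ne_zero _ hp.ne_zero⟩
    exact ZMod.val_lt s
  rw [teichOrbitSum_eq_coeff_comp_mazurTateElement f hp2 n ξ₀ hs (b : ZMod (p ^ (n + 1))) hb] at hb1
  exact exists_sign_hasUnitContent_of_norm_coeff_eq_one hp2 hf hgood hap hb1

/-- **The one-sign μ-rider at an odd good supersingular prime ⟸ B⁰_ss AT THE LEVEL OF THE NEWFORM.**  For `W/ℚ` globally minimal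
with good reduction at the odd prime `p`, `a_p = 0`, its newform `f` of level `N` (so `p ∤ N`), and B⁰_ss at the single pair `(N,p)`
(`TeichSpanGenModHecke N p`, a hypothesis — weaker than CONJ B⁰ `TeichSpanGen N p`): `∃ ε L, IsSignedPAdicLFunction f p ε L ∧ HasUnitContent L`.
Chain: `E[p]` irreducible (Serre Prop. 12 at a good supersingular prime) ⇒ winding non-constancy mod `p` (input-free THEOREM B road) and an
Eisenstein multiple `n₀{∞,0} ∈ Λ_f` prime to `p`; `a_p(f) = a_p(E) = 0`; §B; then the unit orbit sum gives the rider.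
[cite: Serre1972, §1.11 Prop. 12] [cite: MazurTateTeitelbaum1986Invent, §I.4 (4.2), §I.10 (10.1)–(10.2)] [cite: Manin1972, Prop. 1.4] -/
theorem exists_sign_hasUnitContent_of_teichSpanGenModHecke {W : WeierstrassCurve ℚ} [W.IsElliptic] [W.IsGloballyMinimal]
    (hp2 : p ≠ 2) (hf : IsNewformOf W f) (hgood : W.HasGoodReductionAtPrime p) (hap : W.frobeniusTrace p = 0)
    (hB : TeichSpanGenModHecke N p) :
    ∃ (ε : ℤˣ) (L : IwasawaAlgebra p), IsSignedPAdicLFunction f p ε L ∧ HasUnitContent L := by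
  have hpN : ¬ p ∣ N := not_dvd_level_of_isNewformOf hf hgood
  have hirr : W.HasIrreducibleModPGaloisRep p :=
    hasIrreducibleModPGaloisRep_of_dvd_frobeniusTrace W p hp2
      (W.not_dvd_minimalDiscriminantInt_of_hasGoodReductionAtPrime' p hgood) (by rw [hap]; exact dvd_zero _)
  have hcyc : CycWindingNonConstantAt W p :=
    Summit.BirchSwinnertonDyer.BirchSwinnertonDyer.Rank1Residual.EvenBranch.cycWindingNonConstantAt_of_odd W p hp2 hgood hirr
  obtain ⟨n₀, hpn₀, h0⟩ :=
    exists_intCast_mul_modularSymbol_zero_mem not_irreducible_of_frobeniusTrace_congr_holds hf hirr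
  exact exists_sign_hasUnitContent_of_one_le_norm_teichOrbitSum f hp2 hf hgood hap
    (exists_one_le_norm_teichOrbitSum_of_teichSpanGenModHecke hf.1 hf.coeffField_eq_bot hp2 hpN
      (cuspCoeff_eq_frobeniusTrace_of_isNewformOf_holds hf hgood) (by rw [hap]; exact dvd_zero _) hpn₀ h0 hB
      (hcyc f hf))

/-- The same from CONJ B⁰ at the newform's level (p648205 §2 recovered through `teichSpanGenModHecke_of_teichSpanGen`; here at
any odd good supersingular prime with `a_p = 0`). [cite: Manin1972, Prop. 1.4] [cite: MazurTateTeitelbaum1986Invent, §I.10 (10.1)] -/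
theorem exists_sign_hasUnitContent_of_teichSpanGen' {W : WeierstrassCurve ℚ} [W.IsElliptic] [W.IsGloballyMinimal]
    (hp2 : p ≠ 2) (hf : IsNewformOf W f) (hgood : W.HasGoodReductionAtPrime p) (hap : W.frobeniusTrace p = 0)
    (hB : TeichSpanGen N p) :
    ∃ (ε : ℤˣ) (L : IwasawaAlgebra p), IsSignedPAdicLFunction f p ε L ∧ HasUnitContent L :=
  exists_sign_hasUnitContent_of_teichSpanGenModHecke f hp2 hf hgood hap (teichSpanGenModHecke_of_teichSpanGen hB)

/-- **The rider from B⁰_ss at all levels** (`TeichSpanGenModHeckeAll`, a hypothesis; `p ≥ 5`, good supersingular, `a_p = 0`).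
[cite: MazurTateTeitelbaum1986Invent, §I.10 (10.1)] [cite: PollackWeston2011, Thm. 4.1 (1)] -/
theorem exists_sign_hasUnitContent_of_teichSpanGenModHeckeAll (hB : TeichSpanGenModHeckeAll) {W : WeierstrassCurve ℚ}
    [W.IsElliptic] [W.IsGloballyMinimal] (hp5 : 5 ≤ p) (hf : IsNewformOf W f) (hgood : W.HasGoodReductionAtPrime p)
    (hap : W.frobeniusTrace p = 0) :
    ∃ (ε : ℤˣ) (L : IwasawaAlgebra p), IsSignedPAdicLFunction f p ε L ∧ HasUnitContent L :=
  exists_sign_hasUnitContent_of_teichSpanGenModHecke f (by omega) hf hgood hap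
    (hB N p Fact.out hp5 (not_dvd_level_of_isNewformOf hf hgood))

end Rider

/-! ### §D The registered stub `stub_muOneSign_ns_ge5`, VERBATIM, from B⁰_ss on the crux's own population of levels -/

section Stub

/-- **`stub_muOneSign_ns_ge5` of line `birth_acns` v11, VERBATIM, from «B⁰_ss at the CONDUCTOR LEVEL of every pair of the class»**:
the hypothesis quantifies over the crux's population only (class X7, non-CM, good supersingular `p ≥ 5` with `a_p = 0`, `ρ̄_{E,p}` not
surjective) and asks `TeichSpanGenModHecke N_E p` there — strictly inside p648205's hypothesis «`TeichSpanGen N_E p` on the class»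
(`teichSpanGenModHecke_of_teichSpanGen`).  The class hypotheses are passed through unused.
[cite: MazurTateTeitelbaum1986Invent, §I.4 (4.2), §I.10 (10.1)] [cite: PollackWeston2011, Thm. 4.1 (1)] -/
theorem muOneSign_ns_ge5_of_teichSpanGenModHecke_conductor
    (hB : ∀ (W : WeierstrassCurve ℚ) [W.IsElliptic] [W.IsGloballyMinimal] (p : ℕ) [Fact p.Prime], 5 ≤ p →
      ClassX7 W p → ¬ W.HasCM → W.frobeniusTrace p = 0 → ¬ Surj W p → TeichSpanGenModHecke (W.conductorNorm ℤ) p) :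
    ∀ (W : WeierstrassCurve ℚ) [W.IsElliptic] [W.IsGloballyMinimal] (p : ℕ) [Fact p.Prime], 5 ≤ p →
    ClassX7 W p → ¬ W.HasCM → W.frobeniusTrace p = 0 → ¬ Surj W p →
    ∀ [NeZero (W.conductorNorm ℤ)] (f : CuspForm (Gamma0 (W.conductorNorm ℤ)) 2),
    IsNewformOf W f → ∃ (ε₀ : ℤˣ) (L₀ : IwasawaAlgebra p), IsSignedPAdicLFunction f p ε₀ L₀ ∧ HasUnitContent L₀ := by
  intro W _ _ p _ hp5 hX hCM hap hs _ f hf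
  exact exists_sign_hasUnitContent_of_teichSpanGenModHecke f (by omega) hf hX.1.1 hap (hB W p hp5 hX hCM hap hs)

/-- **`stub_muOneSign_ns_ge5` VERBATIM from the closed `Prop` `TeichSpanGenModHeckeAll`** (B⁰_ss at every level prime to `p`, every
`p ≥ 5`; a hypothesis).  [cite: MazurTateTeitelbaum1986Invent, §I.10 (10.1)] [cite: PollackWeston2011, Thm. 4.1 (1)] -/
theorem muOneSign_ns_ge5_of_teichSpanGenModHeckeAll (hB : TeichSpanGenModHeckeAll) :
    ∀ (W : WeierstrassCurve ℚ) [W.IsElliptic] [W.IsGloballyMinimal] (p : ℕ) [Fact p.Prime], 5 ≤ p →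
    ClassX7 W p → ¬ W.HasCM → W.frobeniusTrace p = 0 → ¬ Surj W p →
    ∀ [NeZero (W.conductorNorm ℤ)] (f : CuspForm (Gamma0 (W.conductorNorm ℤ)) 2),
    IsNewformOf W f → ∃ (ε₀ : ℤˣ) (L₀ : IwasawaAlgebra p), IsSignedPAdicLFunction f p ε₀ L₀ ∧ HasUnitContent L₀ := by
  intro W _ _ p _ hp5 hX _ hap _ _ f hf
  exact exists_sign_hasUnitContent_of_teichSpanGenModHeckeAll f hB hp5 hf hX.1.1 hap

end Stub

end Summit.BirchSwinnertonDyer.BirchSwinnertonDyer.Theorems.SmallImageTeichSpanHecke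

end
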